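import Summits.QuantumFields.YangMills.Theorems.ReplicaVarianceTiltHeightChiSqLEmlInjectivity

/-!
# Route `ReplicaVarianceTilt` — crux `HeightChiSqL` (stmt-QuantumFields-26133), toward the residual of `stub_acIntegrable`:
# THE GUARDED EXP-MEAN-LOG FIBRE LAWS ON `SU(2)` ARE DOMINATED BY HAAR MEASURE, UNIFORMLY IN THE FROZEN HOLONOMIES
# (the quantitative form of `T4EMLFibreAC`; helper `--supports stmt-QuantumFields-26133`)

Width seat `ym-line-sfw-p2-w3` gen 21 (home cell `ym-idea-1`; R3 RECORD rung — no summit, no rung and no crux is proved here; the YM mass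
gap is NOT proved by any of this).  Assembly of the series: `exists_uniform_tangent_floor` (`…EmlDTangentFloor`, input (a)),
`exists_uniform_injRadius_su2` (`…EmlInjectivity`, input (b)), a finite `r/2`-net of the compact `SU(2)` (Mathlib
`finite_cover_balls_of_compact`), and the matrix-form quantitative Lemma A `…HaarDominatedMatrix.haarData_restrict_map_le_smul_of_matrix`.
* `exists_eml_fibre_le_smul` — **for weights `cᵢ ≥ 0` with `Σ cᵢ < 1` there is ONE constant `C < ∞` such that for EVERY family
  `hᵢ ∈ SU(2)`, every open `S ⊆ SU(2)` inside the guard `‖hᵢ W* − 1‖ < 1/3`, and every measurable `K : SU(2) → SU(2)` agreeing on `S` with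
  `W ↦ exp(Σᵢ cᵢ log(hᵢ W*))·W`, `((Haar).restrict S).map K ≤ C • Haar`** (binder shape of `T4EMLTangentInjective.eml_fibre_absolutelyContinuous_specialUnitary`,
  with `≪` upgraded to `≤ C •` and `C` independent of `h`, `S`, `K`).
Every declaration is [folklore]; no estimate of Bałaban's is used.  What is left for the stub: the lattice instantiation
(`BlockAveragingEMLHaarAC.coe_fibreCore_eq`) and `HeightChiSqLOfFibreLawBound.stubText_of_fibreLawBound` (next file).
-/

noncomputable section

open MeasureTheory Set Filter Topology Function Metric

namespace Summit.QuantumFields.YangMills.Theorems.HeightChiSqLEmlFibreLawBound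

open scoped Matrix Matrix.Norms.L2Operator ENNReal
open Literature.MathematicalPhysics.QuantumFieldTheory.Balaban1983to89.T4EMLTangentInjective (Kmat emlD hasStrictFDerivAt_Kmat)
open Summit.QuantumFields.YangMills.Theorems.HeightChiSqLEmlDTangentFloor (exists_uniform_tangent_floor)
open Summit.QuantumFields.YangMills.Theorems.HeightChiSqLEmlInjectivity (exists_uniform_injRadius_su2)
open Summit.QuantumFields.YangMills.Theorems.HeightChiSqLHaarDominatedMatrix (haarData_restrict_map_le_smul_of_matrix)

variable {ι : Type*} [Fintype ι]

/-- **THE GUARDED EXP-MEAN-LOG FIBRE LAWS ON `SU(2)` ARE UNIFORMLY DOMINATED BY HAAR MEASURE.** [folklore] -/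
theorem exists_eml_fibre_le_smul (c : ι → ℝ) (hc0 : ∀ i, 0 ≤ c i) (hc1 : ∑ i, c i < 1) :
    ∃ C : ℝ≥0∞, C ≠ ⊤ ∧ ∀ (h : ι → Matrix.specialUnitaryGroup (Fin 2) ℂ)
      {S : Set (Matrix.specialUnitaryGroup (Fin 2) ℂ)}, IsOpen S →
      (∀ W ∈ S, ∀ i, ‖((h i : Matrix (Fin 2) (Fin 2) ℂ)) * star (W : Matrix (Fin 2) (Fin 2) ℂ) - 1‖ < 1 / 3) →
      ∀ {K : Matrix.specialUnitaryGroup (Fin 2) ℂ → Matrix.specialUnitaryGroup (Fin 2) ℂ}, Measurable K →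
      (∀ W ∈ S, Kmat (fun i => (h i : Matrix (Fin 2) (Fin 2) ℂ)) c (W : Matrix (Fin 2) (Fin 2) ℂ) =
        ((K W : Matrix.specialUnitaryGroup (Fin 2) ℂ) : Matrix (Fin 2) (Fin 2) ℂ)) →
      ((Literature.MathematicalPhysics.QuantumFieldTheory.Balaban1983to89.HaarData.haar :
          Measure (Matrix.specialUnitaryGroup (Fin 2) ℂ)).restrict S).map K ≤
        C • (Literature.MathematicalPhysics.QuantumFieldTheory.Balaban1983to89.HaarData.haar :
          Measure (Matrix.specialUnitaryGroup (Fin 2) ℂ)) := by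
  -- (a) the uniform tangent floor and (b) the uniform injectivity radius
  obtain ⟨c₀, hc₀, hc₀1, hfloor⟩ := exists_uniform_tangent_floor (m := Fin 2) c hc0 hc1 (δ := 1 / 3) (by norm_num)
  obtain ⟨r, hr, hinj⟩ := exists_uniform_injRadius_su2 c hc₀ hc₀1 hfloor
  -- a finite `r/2`-net of `SU(2)`
  obtain ⟨t, -, ht, hcov⟩ := finite_cover_balls_of_compact
    (isCompact_univ : IsCompact (Set.univ : Set (Matrix.specialUnitaryGroup (Fin 2) ℂ))) (half_pos hr)
  set n : ℕ := ht.toFinset.card with hn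
  set e := ht.toFinset.equivFin with he
  set z : Fin n → Matrix.specialUnitaryGroup (Fin 2) ℂ := fun k => (e.symm k).1 with hz
  refine ⟨(n : ℝ≥0∞) * (ENNReal.ofReal (c₀ ^ 4))⁻¹, ?_, ?_⟩
  · refine ENNReal.mul_ne_top (ENNReal.natCast_ne_top n) (ENNReal.inv_ne_top.2 ?_)
    exact (ENNReal.ofReal_pos.2 (by positivity)).ne'
  intro h S hS hSg K hK hKmat
  -- the pieces `S ∩ B(z_k, r/2)`
  set piece : Fin n → Set (Matrix.specialUnitaryGroup (Fin 2) ℂ) := fun k => S ∩ ball (z k) (r / 2) with hpiece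
  have hpm : ∀ k, MeasurableSet (piece k) := fun k => hS.measurableSet.inter measurableSet_ball
  have hcover : S ⊆ ⋃ k, piece k := by
    intro W hW
    obtain ⟨x, hxt, hWx⟩ : ∃ x ∈ t, W ∈ ball x (r / 2) := by
      have := hcov (Set.mem_univ W)
      simpa only [Set.mem_iUnion, exists_prop] using this
    have hxt' : x ∈ ht.toFinset := ht.mem_toFinset.2 hxt
    refine Set.mem_iUnion.2 ⟨e ⟨x, hxt'⟩, hW, ?_⟩
    show W ∈ ball (z (e ⟨x, hxt'⟩)) (r / 2)
    simp only [hz, Equiv.symm_apply_apply]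
    exact hWx
  have hinjK : ∀ k, InjOn K (piece k) := by
    intro k W₁ hW₁ W₂ hW₂ hKW
    have hd : ‖(W₁ : Matrix (Fin 2) (Fin 2) ℂ) - W₂‖ < r := by
      have h1 : dist W₁ (z k) < r / 2 := hW₁.2
      have h2 : dist W₂ (z k) < r / 2 := hW₂.2
      have h3 : dist W₁ W₂ < r := by
        calc dist W₁ W₂ ≤ dist W₁ (z k) + dist W₂ (z k) := dist_triangle_right _ _ _
          _ < r / 2 + r / 2 := add_lt_add h1 h2
          _ = r := by ring
      rwa [Subtype.dist_eq, dist_eq_norm] at h3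
    have hKm : Kmat (fun i => (h i : Matrix (Fin 2) (Fin 2) ℂ)) c (W₁ : Matrix (Fin 2) (Fin 2) ℂ) =
        Kmat (fun i => (h i : Matrix (Fin 2) (Fin 2) ℂ)) c (W₂ : Matrix (Fin 2) (Fin 2) ℂ) := by
      rw [hKmat W₁ hW₁.1, hKmat W₂ hW₂.1, hKW]
    exact hinj (fun i => (h i : Matrix (Fin 2) (Fin 2) ℂ)) (fun i => (h i).2) W₁ W₂
      (fun i => (hSg W₁ hW₁.1 i).le) (fun i => (hSg W₂ hW₂.1 i).le) hd hKm
  -- the quantitative Lemma A, matrix form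
  refine haarData_restrict_map_le_smul_of_matrix hS hK
    (Kmat := Kmat (fun i => (h i : Matrix (Fin 2) (Fin 2) ℂ)) c)
    (D := fun W => emlD (fun i => (h i : Matrix (Fin 2) (Fin 2) ℂ)) c (W : Matrix (Fin 2) (Fin 2) ℂ))
    (fun W hW => hasStrictFDerivAt_Kmat _ c fun i => lt_trans (hSg W hW i) (by norm_num)) hKmat hc₀ hc₀1
    (fun W hW X hX _ => hfloor (fun i => (h i : Matrix (Fin 2) (Fin 2) ℂ)) (W : Matrix (Fin 2) (Fin 2) ℂ)
      (fun i => (Matrix.mem_specialUnitaryGroup_iff.mp (h i).2).1) (Matrix.mem_specialUnitaryGroup_iff.mp W.2).1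
      (fun i => (hSg W hW i).le) X hX)
    piece hpm hcover hinjK

end Summit.QuantumFields.YangMills.Theorems.HeightChiSqLEmlFibreLawBound

end
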